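import Mathlib
import HarnessLib
import Summits.HubbardSuperconductivity.HubbardSuperconductivity.Theorems.KLProgrammePerturbedFermiCurveTower
import Summits.HubbardSuperconductivity.HubbardSuperconductivity.Theorems.KLProgrammeKLRegimeSplitTwoLegSizesMSChainTable

/-!
# Route `KLProgramme` — DEFINITION LANE for the curve tower at ORDERS 5 and 6: the radius-tower tops `klCurveT5`, `klCurveT6`, the
# curve sizes `klCurveD5`, `klCurveD6`, and the extended term table `msD6` (agrees with `msD` up to order 4)

Cell `gate-hubbard-kl`, seat hubbard-kl-k3c3-p3 (g18; row «implicit-function / monotonicity route»).  Located brick «(T)-TOWER-56» for the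
(C)-closer lane (stub (C) `stub_twoLeg_curvature` of `KLRegimeEngineV17F2`, stmt-HubbardSuperconductivity-20437; c4a-1 C4A-PLAN §24.9:
«orders 3–4 at (T) wait for tables msD 5,6 / K₅,K₆»).  The constants are the right-hand sides of the GENERIC level tower
`…PerturbedFermiCurveLevelTowerFaaDiBruno.abs_iteratedDeriv_radius_le_of_level` (`|u⁽ⁿ⁾| ≤ (n!·E_max·Gⁿ + E₁·Σ_{i<n} C(n,i)Rᵢ)/ρ₀`) for the
frame's Fermi radius in the Momentum frame `w = toLp ∘ dir` (‖w⁽ᵏ⁾‖ = 1), with the lineage's relaxations `A ≤ 1/20` (orders ≤ 2), `ρ₀ = Dt_min − 2A ≥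
klCurveD`, the bare-band size `‖Dᵐ(ε − μ)‖ ≤ 4` on `Momentum`, and the landed orders `≤ 4` (`klCurveR1`, `klCurveR2`, `klCurveT3 A₃`, `klCurveT4 A₃ A₄`,
`klCurveD1 … D4`) as the lower jets:

* `klCurveG5 A₃ A₄ = max(D1, D2^{1/2}, D3^{1/3}, D4^{1/4})` (the geometric scale of the lower curve jets, `Dᵢ ≤ G5ⁱ`), `klCurveG6` (adds `D5^{1/5}`);
* `klCurveL5 A₃ A₄ = π√2 + 5R1 + 10R2 + 10T3 + 5T4` (`= Σ_{i<5} C(5,i)·Rᵢ`), `klCurveL6`;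
* **`klCurveT5 A₃ A₄ A₅ = (120·(4 + 1/20 + A₃ + A₄ + A₅)·G5⁵ + (4 + 1/20)·L5)/klCurveD`**, **`klCurveT6 A₃ A₄ A₅ A₆`** (`720`, `G6⁶`, `L6`);
* **`klCurveD5 = L5 + T5`**, **`klCurveD6 = L6 + T6`** (`= Σ_{i≤n} C(n,i)·Rᵢ`: the Momentum curve `γ = u • w`, no `‖toLp‖` factor);
* **`msD6 A₃ A₄ A₅ A₆ : ℕ → ℝ`** — `msD A₃ A₄` at `1 … 4`, `klCurveD5/6` at `5, 6`, `0` else; `msD6_eq_msD` (`j ≤ 4`), `msD6_five`, `msD6_six`.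

Here `A₅ = ‖D⁵ frameShift K‖`, `A₆ = ‖D⁶ frameShift K‖` (sizes on `Momentum`, as `A₃, A₄`).  The proofs that these bound the frame's curve
(`fermiPointLp_sizes_of_sizes_six`, `norm_iteratedDeriv_levelPoint_le_six`) are `…PerturbedFermiCurveTowerOfSizesSix`.  Definitions of real
constants + `rfl`/case lemmas only; no instances, no notation; nothing is asserted about the Hubbard model.
References: BGM 2006 §2.4 Lemma 2.1 (2.40) [cite: BenfattoGiulianiMastropietro2006].
-/

noncomputable section

namespace Summit.HubbardSuperconductivity.HubbardSuperconductivity.Theorems.PerturbedFermiCurve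

set_option linter.dupNamespace false -- summit = problem name (single-conjunct summit), D-0017

open Real

/-- **Geometric scale of the lower curve jets at order 5**: `G5 = max(D1, D2^{1/2}, D3^{1/3}, D4^{1/4})`, so that `klCurveDᵢ ≤ G5ⁱ` (`i ≤ 4`). -/
def klCurveG5 (A₃ A₄ : ℝ) : ℝ :=
  max (max (max klCurveD1 (klCurveD2 ^ ((2 : ℝ)⁻¹))) (klCurveD3 A₃ ^ ((3 : ℝ)⁻¹))) (klCurveD4 A₃ A₄ ^ ((4 : ℝ)⁻¹))

/-- **Lower radius tower weighted by the order-5 binomials**: `L5 = π√2 + 5R1 + 10R2 + 10T3(A₃) + 5T4(A₃,A₄)` (`= Σ_{i<5} C(5,i)·Rᵢ`, `R₀ = π√2 ≥ |u|`). -/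
def klCurveL5 (A₃ A₄ : ℝ) : ℝ :=
  π * Real.sqrt 2 + 5 * klCurveR1 + 10 * klCurveR2 + 10 * klCurveT3 A₃ + 5 * klCurveT4 A₃ A₄

/-- **Order-5 radius-tower top** `T5(A₃,A₄,A₅) = (120·(4 + 1/20 + A₃ + A₄ + A₅)·G5⁵ + (4 + 1/20)·L5)/klCurveD` — a bound of `|u_K⁽⁵⁾|`
(`…TowerOfSizesSix.frameRadius_tower_of_sizes_six`); affine in the order-5 size `A₅ = ‖D⁵ frameShift K‖`. -/
def klCurveT5 (A₃ A₄ A₅ : ℝ) : ℝ :=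
  (120 * (4 + 1 / 20 + A₃ + A₄ + A₅) * klCurveG5 A₃ A₄ ^ 5 + (4 + 1 / 20) * klCurveL5 A₃ A₄) / klCurveD

/-- **Curve size, order 5**: `D5 = L5 + T5 = Σ_{i≤5} C(5,i)·Rᵢ` — a bound of `‖∂⁵_ϑ toLp(k_F^K(ϑ))‖` (Momentum frame `toLp∘dir`, `‖w⁽ᵏ⁾‖ = 1`). -/
def klCurveD5 (A₃ A₄ A₅ : ℝ) : ℝ := klCurveL5 A₃ A₄ + klCurveT5 A₃ A₄ A₅

/-- **Geometric scale of the lower curve jets at order 6**: `G6 = max(G5, D5^{1/5})`. -/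
def klCurveG6 (A₃ A₄ A₅ : ℝ) : ℝ := max (klCurveG5 A₃ A₄) (klCurveD5 A₃ A₄ A₅ ^ ((5 : ℝ)⁻¹))

/-- **Lower radius tower weighted by the order-6 binomials**: `L6 = π√2 + 6R1 + 15R2 + 20T3 + 15T4 + 6T5` (`= Σ_{i<6} C(6,i)·Rᵢ`). -/
def klCurveL6 (A₃ A₄ A₅ : ℝ) : ℝ :=
  π * Real.sqrt 2 + 6 * klCurveR1 + 15 * klCurveR2 + 20 * klCurveT3 A₃ + 15 * klCurveT4 A₃ A₄ + 6 * klCurveT5 A₃ A₄ A₅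

/-- **Order-6 radius-tower top** `T6(A₃,A₄,A₅,A₆) = (720·(4 + 1/20 + A₃ + A₄ + A₅ + A₆)·G6⁶ + (4 + 1/20)·L6)/klCurveD` — a bound of `|u_K⁽⁶⁾|`;
affine in the order-6 size `A₆ = ‖D⁶ frameShift K‖`. -/
def klCurveT6 (A₃ A₄ A₅ A₆ : ℝ) : ℝ :=
  (720 * (4 + 1 / 20 + A₃ + A₄ + A₅ + A₆) * klCurveG6 A₃ A₄ A₅ ^ 6 + (4 + 1 / 20) * klCurveL6 A₃ A₄ A₅) / klCurveD

/-- **Curve size, order 6**: `D6 = L6 + T6 = Σ_{i≤6} C(6,i)·Rᵢ`. -/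
def klCurveD6 (A₃ A₄ A₅ A₆ : ℝ) : ℝ := klCurveL6 A₃ A₄ A₅ + klCurveT6 A₃ A₄ A₅ A₆

/-- `D5 = L5 + T5`. -/
theorem klCurveD5_eq (A₃ A₄ A₅ : ℝ) : klCurveD5 A₃ A₄ A₅ = klCurveL5 A₃ A₄ + klCurveT5 A₃ A₄ A₅ := rfl

/-- `D6 = L6 + T6`. -/
theorem klCurveD6_eq (A₃ A₄ A₅ A₆ : ℝ) : klCurveD6 A₃ A₄ A₅ A₆ = klCurveL6 A₃ A₄ A₅ + klCurveT6 A₃ A₄ A₅ A₆ := rfl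

end Summit.HubbardSuperconductivity.HubbardSuperconductivity.Theorems.PerturbedFermiCurve

namespace Summit.HubbardSuperconductivity.HubbardSuperconductivity.Theorems.KLRegimeSplit

set_option linter.dupNamespace false -- summit = problem name (single-conjunct summit), D-0017

open Summit.HubbardSuperconductivity.HubbardSuperconductivity.Theorems.PerturbedFermiCurve

/-- **THE EXTENDED CURVE TOWER TABLE** `msD6`: `msD A₃ A₄` at orders `1 … 4`, `klCurveD5 A₃ A₄ A₅` at `5`, `klCurveD6 A₃ A₄ A₅ A₆` at `6`, `0` else. -/
def msD6 (A₃ A₄ A₅ A₆ : ℝ) : ℕ → ℝ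
  | 1 => klCurveD1
  | 2 => klCurveD2
  | 3 => klCurveD3 A₃
  | 4 => klCurveD4 A₃ A₄
  | 5 => klCurveD5 A₃ A₄ A₅
  | 6 => klCurveD6 A₃ A₄ A₅ A₆
  | _ => 0

/-- `msD6` agrees with `msD` up to order four (and at every index except `5, 6`). -/
theorem msD6_eq_msD (A₃ A₄ A₅ A₆ : ℝ) {j : ℕ} (hj : j ≤ 4) : msD6 A₃ A₄ A₅ A₆ j = msD A₃ A₄ j := by
  rcases j with _ | _ | _ | _ | _ | j
  · rfl
  · rfl
  · rfl
  · rfl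
  · rfl
  · omega

/-- `msD6 … 0 = 0`. -/
theorem msD6_zero (A₃ A₄ A₅ A₆ : ℝ) : msD6 A₃ A₄ A₅ A₆ 0 = 0 := rfl

/-- `msD6 … 5 = klCurveD5 A₃ A₄ A₅`. -/
theorem msD6_five (A₃ A₄ A₅ A₆ : ℝ) : msD6 A₃ A₄ A₅ A₆ 5 = klCurveD5 A₃ A₄ A₅ := rfl

/-- `msD6 … 6 = klCurveD6 A₃ A₄ A₅ A₆`. -/
theorem msD6_six (A₃ A₄ A₅ A₆ : ℝ) : msD6 A₃ A₄ A₅ A₆ 6 = klCurveD6 A₃ A₄ A₅ A₆ := rfl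

/-- Beyond order six the table is `0`. -/
theorem msD6_of_seven_le (A₃ A₄ A₅ A₆ : ℝ) {j : ℕ} (hj : 7 ≤ j) : msD6 A₃ A₄ A₅ A₆ j = 0 := by
  rcases j with _ | _ | _ | _ | _ | _ | _ | j
  all_goals first | omega | rfl

end Summit.HubbardSuperconductivity.HubbardSuperconductivity.Theorems.KLRegimeSplit

end
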